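import Summits.CriticalPhenomena.PercolationContinuityZ3.Theorems.PercNearOneGluingAdditiveGluingGenPair
import Literature.Probability.Percolation.KozmaNitzanSeparatingTriple
import HarnessLib

/-!
# The POCKET BASE INEQUALITY (T2): avoiding a source set is easier for two separated small clusters than for the joined one

Support file (`--supports stmt-CriticalPhenomena-4575`, closed crux; independent mathematics on Kozma–Nitzan's Question 8), prover
`prim-ineq-gen-6` (gen 13).  No definitions, no named facts, no sorries; standard axioms.  Memo `prim-ineq-gen-6/FINDING-G13.md` §2 Lemma 2 and §8(iii).

In the two-source (META-A2) organisation of the pocket covariance comparison PCOV for KN Question 8 at `|A| = 3` (memo §8: `CovTau.metaA2_abstract` with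
`(f₁,f₂,f₃,f₄) = (⟨e⟩, ⟨h₁⟩, ⟨α⟩, ⟨A⟩)`, the pocket-avoid set growing with the source set) the disjoint-sources base factors as (★₁) × (T2), where (T2) is the
purely probabilistic inequality proved here.  Owner `x`, observer `o`, marker `v`, a down-closed family `𝒟` of vertex sets all avoiding `x` (the admissible pockets of `o`),
`P = {C_o ∈ 𝒟}`, and two arbitrary vertex sets `N, N'`:
* `PocketCert.pocket_base` —
  `μ(o↔v ∩ v↮x ∩ v↮N) · μ(v↮x ∩ v↮N' ∩ o↮N' ∩ P) ≤ μ(o↔v ∩ v↮x) · μ(v↮x ∩ v↮(N∪N') ∩ o↮(N∪N') ∩ P)`,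
  i.e. `P(v↮N | o∈C_v, v↮x) ≤ P(v↮N, o↮N | v↮x∪N', o↮N', P)` whenever the conditional probabilities make sense.
PROOF: two applications of van den Berg–Häggström–Kahn's Theorem 2.1 at `q = 1` with the SETS `S = {v,o}`, `T = {x}` (tree
`BHK2006_twoSetConditionalAssociation`): given `{S ↮ T} = {v↮x} ∩ {o↮x}`, `A = 1{o↔v}` is increasing, and `R_N = 1{S↮N}`, `R_{N'}·1_P` are decreasing functions of the
edge cluster of `S` (`P` is decreasing because `𝒟` is down-closed), hence `μ(D)·∫_D A R_N ≤ (∫_D A)(∫_D R_N)` and `(∫_D R_N)(∫_D R_{N'}1_P) ≤ μ(D)·∫_D R_N R_{N'} 1_P`;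
on `A` one has `{S↮N} = {v↮N}` and `S↮x` is `v↮x`, and `P ⊆ {o↮x}`.
[cite: VandenbergHaggstromKahn2005, Thm. 2.1 (p. 9), Remark 1 after Thm. 1.2 (p. 5)] [cite: KozmaNitzan2024, Question 8 (§5.5 p. 36)]
-/

namespace Summit.CriticalPhenomena.PercolationContinuityZ3.Theorems

open MeasureTheory Set Literature.Probability.LatticeModels Literature.Probability.Percolation
open scoped Classical
open KNPreFKG

noncomputable section

namespace PocketCert

variable {V : Type*} [Fintype V]

/-- **(T2) — the pocket base inequality.**  `𝒟` down-closed, all pockets avoid `x`; `P = {C_o ∈ 𝒟}`; `N, N'` arbitrary vertex sets.  Then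
`μ({o↔v} ∩ {v↮x} ∩ {v↮N}) · μ({v↮x} ∩ {v↮N'} ∩ {o↮N'} ∩ P) ≤ μ({o↔v} ∩ {v↮x}) · μ({v↮x} ∩ {v↮N∪N'} ∩ {o↮N∪N'} ∩ P)`.
Two applications of van den Berg–Häggström–Kahn's Thm 2.1 (`q = 1`) with `S = {v,o}`, `T = {x}`.
[cite: VandenbergHaggstromKahn2005, Thm. 2.1 (p. 9)] [cite: KozmaNitzan2024, Question 8 (§5.5 p. 36)] -/
theorem pocket_base (w : Sym2 V → unitInterval) (o x v : V) (𝒟 : Set (Set V)) (h𝒟 : IsLowerSet 𝒟)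
    (hx : ∀ W ∈ 𝒟, x ∉ W) (N N' : Set V) :
    (prodBernoulli w).real (openConn v o ∩ {ω | ¬ (openGraph ω).Reachable v x} ∩ {ω | ∀ u ∈ N, ¬ (openGraph ω).Reachable v u}) *
      (prodBernoulli w).real ({ω : BondConfig V | ¬ (openGraph ω).Reachable v x} ∩ {ω | ∀ u ∈ N', ¬ (openGraph ω).Reachable v u} ∩
        {ω | ∀ u ∈ N', ¬ (openGraph ω).Reachable o u} ∩ {ω | openCluster ω o ∈ 𝒟}) ≤
    (prodBernoulli w).real (openConn v o ∩ {ω | ¬ (openGraph ω).Reachable v x}) *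
      (prodBernoulli w).real ({ω : BondConfig V | ¬ (openGraph ω).Reachable v x} ∩ {ω | ∀ u ∈ N ∪ N', ¬ (openGraph ω).Reachable v u} ∩
        {ω | ∀ u ∈ N ∪ N', ¬ (openGraph ω).Reachable o u} ∩ {ω | openCluster ω o ∈ 𝒟}) := by
  classical
  set μ := prodBernoulli w with hμ
  have hmeas : ∀ S' : Set (BondConfig V), MeasurableSet S' := fun _ => MeasurableSet.of_discrete
  have hn := fun (S' : Set (BondConfig V)) => (measureReal_nonneg : 0 ≤ μ.real S')
  set S : Set V := {v, o} with hS
  set T : Set V := {x} with hT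
  set D : Set (BondConfig V) := {ω : BondConfig V | ∀ s ∈ S, ∀ t ∈ T, ¬ (openGraph ω).Reachable s t} with hD
  have hvS : v ∈ S := by simp [hS]
  have hoS : o ∈ S := by simp [hS]
  -- functions of the edge cluster `C` of `S`
  set Ae : Set (Sym2 V) → ℝ := fun C => if (openGraph C).Reachable v o then 1 else 0 with hAe
  set RN : Set (Sym2 V) → ℝ := fun C =>
    if (∀ u ∈ N, ¬ (openGraph C).Reachable v u) ∧ (∀ u ∈ N, ¬ (openGraph C).Reachable o u) then 1 else 0 with hRN
  set RP : Set (Sym2 V) → ℝ := fun C =>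
    if ((∀ u ∈ N', ¬ (openGraph C).Reachable v u) ∧ (∀ u ∈ N', ¬ (openGraph C).Reachable o u)) ∧ openCluster C o ∈ 𝒟 then 1 else 0
    with hRP
  have hAe_mono : Monotone Ae := by
    intro C C' hCC'
    simp only [hAe]
    by_cases h : (openGraph C).Reachable v o
    · rw [if_pos h, if_pos (h.mono (openGraph_mono hCC'))]
    · rw [if_neg h]; split_ifs <;> norm_num
  have hRN_anti : Antitone RN := by
    intro C C' hCC'
    simp only [hRN]
    by_cases h : (∀ u ∈ N, ¬ (openGraph C').Reachable v u) ∧ (∀ u ∈ N, ¬ (openGraph C').Reachable o u)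
    · have h' : (∀ u ∈ N, ¬ (openGraph C).Reachable v u) ∧ (∀ u ∈ N, ¬ (openGraph C).Reachable o u) :=
        ⟨fun u hu hr => h.1 u hu (hr.mono (openGraph_mono hCC')), fun u hu hr => h.2 u hu (hr.mono (openGraph_mono hCC'))⟩
      rw [if_pos h, if_pos h']
    · rw [if_neg h]; split_ifs <;> norm_num
  have hRP_anti : Antitone RP := by
    intro C C' hCC'
    simp only [hRP]
    by_cases h : ((∀ u ∈ N', ¬ (openGraph C').Reachable v u) ∧ (∀ u ∈ N', ¬ (openGraph C').Reachable o u)) ∧ openCluster C' o ∈ 𝒟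
    · have h' : ((∀ u ∈ N', ¬ (openGraph C).Reachable v u) ∧ (∀ u ∈ N', ¬ (openGraph C).Reachable o u)) ∧ openCluster C o ∈ 𝒟 :=
        ⟨⟨fun u hu hr => h.1.1 u hu (hr.mono (openGraph_mono hCC')), fun u hu hr => h.1.2 u hu (hr.mono (openGraph_mono hCC'))⟩,
          h𝒟 (openCluster_mono hCC' o) h.2⟩
      rw [if_pos h, if_pos h']
    · rw [if_neg h]; split_ifs <;> norm_num
  -- the three indicator events as events of `ω`
  set EA : Set (BondConfig V) := openConn v o with hEA
  set EN : Set (BondConfig V) := {ω | ∀ u ∈ N, ¬ (openGraph ω).Reachable v u} ∩ {ω | ∀ u ∈ N, ¬ (openGraph ω).Reachable o u} with hEN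
  set EP : Set (BondConfig V) := ({ω | ∀ u ∈ N', ¬ (openGraph ω).Reachable v u} ∩ {ω | ∀ u ∈ N', ¬ (openGraph ω).Reachable o u}) ∩
      {ω | openCluster ω o ∈ 𝒟} with hEP
  have hrv : ∀ (ω : BondConfig V) (a : V), (openGraph (⋃ s ∈ S, openEdgeCluster ω s)).Reachable v a ↔ (openGraph ω).Reachable v a :=
    fun ω a => (KNSep.reachable_iff_cluster ω S hvS a).symm
  have hro : ∀ (ω : BondConfig V) (a : V), (openGraph (⋃ s ∈ S, openEdgeCluster ω s)).Reachable o a ↔ (openGraph ω).Reachable o a :=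
    fun ω a => (KNSep.reachable_iff_cluster ω S hoS a).symm
  have hclo : ∀ ω : BondConfig V, openCluster (⋃ s ∈ S, openEdgeCluster ω s) o = openCluster ω o := by
    intro ω; ext a; exact (KNSep.reachable_iff_cluster ω S hoS a).symm
  have hAe_eq : ∀ ω : BondConfig V, Ae (⋃ s ∈ S, openEdgeCluster ω s) = EA.indicator 1 ω := by
    intro ω
    simp only [hAe, hrv ω]
    by_cases h : (openGraph ω).Reachable v o
    · rw [if_pos h, indicator_of_mem (show ω ∈ EA from h), Pi.one_apply]
    · rw [if_neg h, indicator_of_notMem (show ω ∉ EA from h)]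
  have hRN_eq : ∀ ω : BondConfig V, RN (⋃ s ∈ S, openEdgeCluster ω s) = EN.indicator 1 ω := by
    intro ω
    simp only [hRN, hrv ω, hro ω]
    by_cases h : (∀ u ∈ N, ¬ (openGraph ω).Reachable v u) ∧ (∀ u ∈ N, ¬ (openGraph ω).Reachable o u)
    · rw [if_pos h, indicator_of_mem (show ω ∈ EN from h), Pi.one_apply]
    · rw [if_neg h, indicator_of_notMem (show ω ∉ EN from h)]
  have hRP_eq : ∀ ω : BondConfig V, RP (⋃ s ∈ S, openEdgeCluster ω s) = EP.indicator 1 ω := by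
    intro ω
    simp only [hRP, hrv ω, hro ω, hclo ω]
    by_cases h : ((∀ u ∈ N', ¬ (openGraph ω).Reachable v u) ∧ (∀ u ∈ N', ¬ (openGraph ω).Reachable o u)) ∧ openCluster ω o ∈ 𝒟
    · rw [if_pos h, indicator_of_mem (show ω ∈ EP from h), Pi.one_apply]
    · rw [if_neg h, indicator_of_notMem (show ω ∉ EP from h)]
  -- (i) `A` increasing vs `R_N` decreasing: negative correlation given `D`
  have h1 := BHK2006_twoSetConditionalAssociation w S T (fun C _ => Ae C) (fun C _ => -RN C)
    (fun _ => hAe_mono) (fun _ => antitone_const) (fun _ C C' hCC' => neg_le_neg (hRN_anti hCC')) (fun _ => antitone_const)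
  -- (ii) `R_N` and `R_{N'} 1_P` both decreasing: positive correlation given `D`
  have h2 := BHK2006_twoSetConditionalAssociation w S T (fun C _ => -RN C) (fun C _ => -RP C)
    (fun _ C C' hCC' => neg_le_neg (hRN_anti hCC')) (fun _ => antitone_const)
    (fun _ C C' hCC' => neg_le_neg (hRP_anti hCC')) (fun _ => antitone_const)
  simp only [hAe_eq, hRN_eq, hRP_eq, mul_neg, neg_mul, neg_neg, integral_neg] at h1 h2
  -- turn indicator integrals into measures
  have iA : ∫ ω in D, EA.indicator (1 : BondConfig V → ℝ) ω ∂μ = μ.real (D ∩ EA) := setIntegral_indicator_one_eq μ D EA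
  have iN : ∫ ω in D, EN.indicator (1 : BondConfig V → ℝ) ω ∂μ = μ.real (D ∩ EN) := setIntegral_indicator_one_eq μ D EN
  have iP : ∫ ω in D, EP.indicator (1 : BondConfig V → ℝ) ω ∂μ = μ.real (D ∩ EP) := setIntegral_indicator_one_eq μ D EP
  have indmul : ∀ (E1 E2 : Set (BondConfig V)) (ω : BondConfig V),
      E1.indicator (1 : BondConfig V → ℝ) ω * E2.indicator (1 : BondConfig V → ℝ) ω = (E1 ∩ E2).indicator (1 : BondConfig V → ℝ) ω := by
    intro E1 E2 ω
    by_cases h1e : ω ∈ E1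
    · by_cases h2e : ω ∈ E2
      · rw [indicator_of_mem h1e, indicator_of_mem h2e, indicator_of_mem (show ω ∈ E1 ∩ E2 from ⟨h1e, h2e⟩)]; simp
      · rw [indicator_of_notMem h2e, indicator_of_notMem (show ω ∉ E1 ∩ E2 from fun h => h2e h.2)]; simp
    · rw [indicator_of_notMem h1e, indicator_of_notMem (show ω ∉ E1 ∩ E2 from fun h => h1e h.1)]; simp
  have iAN : ∫ ω in D, EA.indicator (1 : BondConfig V → ℝ) ω * EN.indicator (1 : BondConfig V → ℝ) ω ∂μ = μ.real (D ∩ (EA ∩ EN)) := by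
    rw [← setIntegral_indicator_one_eq μ D (EA ∩ EN)]
    exact setIntegral_congr_fun (hmeas D) fun ω _ => indmul EA EN ω
  have iNP : ∫ ω in D, EN.indicator (1 : BondConfig V → ℝ) ω * EP.indicator (1 : BondConfig V → ℝ) ω ∂μ = μ.real (D ∩ (EN ∩ EP)) := by
    rw [← setIntegral_indicator_one_eq μ D (EN ∩ EP)]
    exact setIntegral_congr_fun (hmeas D) fun ω _ => indmul EN EP ω
  rw [iA, iN, iAN] at h1
  rw [iN, iP, iNP] at h2
  -- h1 : μ D * μ(D ∩ (EA ∩ EN)) ≤ μ(D ∩ EA) * μ(D ∩ EN)   (after sign bookkeeping)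
  -- h2 : μ(D ∩ EN) * μ(D ∩ EP) ≤ μ D * μ(D ∩ (EN ∩ EP))
  -- identify the four events of the statement
  have hDv : ∀ ω ∈ D, ¬ (openGraph ω).Reachable v x := fun ω hd => hd v hvS x (by simp [hT])
  have e1 : D ∩ (EA ∩ EN) = openConn v o ∩ {ω | ¬ (openGraph ω).Reachable v x} ∩ {ω | ∀ u ∈ N, ¬ (openGraph ω).Reachable v u} := by
    ext ω
    simp only [hD, hEA, hEN, hS, hT, mem_inter_iff, mem_setOf_eq, openConn, mem_insert_iff, mem_singleton_iff, forall_eq_or_imp, forall_eq]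
    constructor
    · rintro ⟨⟨hvx, hox⟩, hvo, hvN, hoN⟩
      exact ⟨⟨hvo, hvx⟩, hvN⟩
    · rintro ⟨⟨hvo, hvx⟩, hvN⟩
      exact ⟨⟨hvx, fun h => hvx (hvo.trans h)⟩, hvo, hvN, fun u hu h => hvN u hu (hvo.trans h)⟩
  have e2 : D ∩ EA = openConn v o ∩ {ω | ¬ (openGraph ω).Reachable v x} := by
    ext ω
    simp only [hD, hEA, hS, hT, mem_inter_iff, mem_setOf_eq, openConn, mem_insert_iff, mem_singleton_iff, forall_eq_or_imp, forall_eq]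
    constructor
    · rintro ⟨⟨hvx, hox⟩, hvo⟩
      exact ⟨hvo, hvx⟩
    · rintro ⟨hvo, hvx⟩
      exact ⟨⟨hvx, fun h => hvx (hvo.trans h)⟩, hvo⟩
  have e3 : D ∩ EP = {ω : BondConfig V | ¬ (openGraph ω).Reachable v x} ∩ {ω | ∀ u ∈ N', ¬ (openGraph ω).Reachable v u} ∩
        {ω | ∀ u ∈ N', ¬ (openGraph ω).Reachable o u} ∩ {ω | openCluster ω o ∈ 𝒟} := by
    ext ω
    simp only [hD, hEP, hS, hT, mem_inter_iff, mem_setOf_eq, mem_insert_iff, mem_singleton_iff, forall_eq_or_imp, forall_eq]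
    constructor
    · rintro ⟨⟨hvx, hox⟩, ⟨hvN, hoN⟩, hP⟩
      exact ⟨⟨⟨hvx, hvN⟩, hoN⟩, hP⟩
    · rintro ⟨⟨⟨hvx, hvN⟩, hoN⟩, hP⟩
      exact ⟨⟨hvx, fun h => hx _ hP h⟩, ⟨hvN, hoN⟩, hP⟩
  have e4 : D ∩ (EN ∩ EP) = {ω : BondConfig V | ¬ (openGraph ω).Reachable v x} ∩ {ω | ∀ u ∈ N ∪ N', ¬ (openGraph ω).Reachable v u} ∩
        {ω | ∀ u ∈ N ∪ N', ¬ (openGraph ω).Reachable o u} ∩ {ω | openCluster ω o ∈ 𝒟} := by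
    ext ω
    simp only [hD, hEN, hEP, hS, hT, mem_inter_iff, mem_setOf_eq, mem_insert_iff, mem_singleton_iff, forall_eq_or_imp, forall_eq,
      mem_union]
    constructor
    · rintro ⟨⟨hvx, hox⟩, ⟨hvN, hoN⟩, ⟨hvN', hoN'⟩, hP⟩
      refine ⟨⟨⟨hvx, ?_⟩, ?_⟩, hP⟩
      · rintro u (hu | hu)
        · exact hvN u hu
        · exact hvN' u hu
      · rintro u (hu | hu)
        · exact hoN u hu
        · exact hoN' u hu
    · rintro ⟨⟨⟨hvx, hvNN⟩, hoNN⟩, hP⟩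
      exact ⟨⟨hvx, fun h => hx _ hP h⟩, ⟨fun u hu => hvNN u (Or.inl hu), fun u hu => hoNN u (Or.inl hu)⟩,
        ⟨fun u hu => hvNN u (Or.inr hu), fun u hu => hoNN u (Or.inr hu)⟩, hP⟩
  rw [e1, e2] at h1
  rw [e3, e4] at h2
  -- combine:  a·b ≤ (A·n/μD)·b ≤ A·c   where a = μ(D∩EA∩EN), A = μ(D∩EA), n = μ(D∩EN), b = μ(D∩EP), c = μ(D∩EN∩EP)
  set a := μ.real (openConn v o ∩ {ω | ¬ (openGraph ω).Reachable v x} ∩ {ω | ∀ u ∈ N, ¬ (openGraph ω).Reachable v u}) with ha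
  set A' := μ.real (openConn v o ∩ {ω | ¬ (openGraph ω).Reachable v x}) with hA'
  set nn := μ.real (D ∩ EN) with hnn
  set b := μ.real ({ω : BondConfig V | ¬ (openGraph ω).Reachable v x} ∩ {ω | ∀ u ∈ N', ¬ (openGraph ω).Reachable v u} ∩
        {ω | ∀ u ∈ N', ¬ (openGraph ω).Reachable o u} ∩ {ω | openCluster ω o ∈ 𝒟}) with hb
  set c := μ.real ({ω : BondConfig V | ¬ (openGraph ω).Reachable v x} ∩ {ω | ∀ u ∈ N ∪ N', ¬ (openGraph ω).Reachable v u} ∩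
        {ω | ∀ u ∈ N ∪ N', ¬ (openGraph ω).Reachable o u} ∩ {ω | openCluster ω o ∈ 𝒟}) with hc
  set d := μ.real D with hd
  -- h1 : d * a ≤ A' * nn  (up to sign rearrangement) ; h2 : nn * b ≤ d * c
  have h1' : d * a ≤ A' * nn := by linarith
  have h2' : nn * b ≤ d * c := by linarith
  have key : d * (a * b) ≤ d * (A' * c) := by
    have hb0 : 0 ≤ b := hn _
    have hA0 : 0 ≤ A' := hn _
    calc d * (a * b) = (d * a) * b := by ring
      _ ≤ (A' * nn) * b := mul_le_mul_of_nonneg_right h1' hb0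
      _ = A' * (nn * b) := by ring
      _ ≤ A' * (d * c) := mul_le_mul_of_nonneg_left h2' hA0
      _ = d * (A' * c) := by ring
  by_cases hd0 : d = 0
  · -- everything inside `D` is null
    have ha0 : a = 0 := by
      apply le_antisymm _ (hn _)
      calc a = μ.real (D ∩ (EA ∩ EN)) := by rw [e1]
        _ ≤ μ.real D := measureReal_mono inter_subset_left
        _ = 0 := hd0
    rw [ha0, zero_mul]
    exact mul_nonneg (hn _) (hn _)
  · have hdpos : 0 < d := lt_of_le_of_ne (hn _) (Ne.symm hd0)
    exact le_of_mul_le_mul_left key hdpos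

end PocketCert

end

end Summit.CriticalPhenomena.PercolationContinuityZ3.Theorems
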